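import Summits.CriticalPhenomena.SAWScalingLimit.Theorems.SAWDevelopingMapObservableToSLETypeLadderCoOrientedTransport
import HarnessLib

/-!
# Stub S2 `stub_coOrientedReduction` of line `six-class-type-ladder` (crux
`SAWDevelopingMap.ObservableToSLE`, stmt-CriticalPhenomena-10472; lead a2)

**The co-oriented reduction.**  The carved sequential identification (with tightness and modulus
given) for the twin line's r7 family constraint `FatAnchoredClassZero` implies the same statement
for this line's constraint `FatAnchoredCoOriented` (exterior-anchored levels whose clean windows
at both ends are of ONE common class `j : Fin 6`, with class-`j` fat bodies).

Proof.  Fix the data `(D, a, b, ν, f, ε)`.  For each class `j` rotate everything by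
`conj ζ^j`: `D_j = D.map (z ↦ conj ζ^j z)`, `a_j = σ^{-j} ∘ a`, `b_j = σ^{-j} ∘ b`
(`isEmbEndpointApprox_rot`), `ν_j = (conj ζ^j ·)_* ν` (an SLE(8/3) law of `D_j`,
`isSLELaw_map_of_eq_mul`), `f_j = f ∘ (ζ^j ·)_*`; the class-zero statement gives radii `R₀(j)`,
and `R₀ := min_j R₀(j)`.  Given co-oriented data along `δ_k → 0⁺`, if the conclusion failed
frequently then, by pigeonhole on `Fin 6`, it would fail along a subsequence `ψ` on which the
class `j_k = j` is constant (`Filter.extraction_of_frequently_atTop`); along `ψ` the rotated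
families are tame (`tameNestedFamily_rot`), exterior-anchored (`exteriorAnchored_rot`), have
class-ZERO windows (`classZeroWindows_rot`) and class-zero fat bodies (`fatUnderWindow_rot`), the
rotated cells are realised (`cells_rot`), and the rotated carved laws — push-forwards of the carved
laws along the SAW bijection (`map_carvedLaw_rot`) — are probability measures, tight (compact sets
are rotated) and carry the same moduli (`curveClassMap_mem_modulusClass_iff`); so the class-zero
statement applies, and its conclusion transported back (`integral_carvedLaw_rot`,
`integral_map_curveClassMap`, `curveClassMap_symm_map`) IS the failed inequality — contradiction.
No definition is introduced.
-/

noncomputable section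

open scoped Topology NNReal ENNReal ComplexConjugate BoundedContinuousFunction
open Filter Set MeasureTheory Metric
open Literature.Probability.LatticeModels (HexVertex hexGraph hexCenter triZeta)
open Literature.Probability.RandomPlanarGeometry
open Literature.Probability.RandomPlanarGeometry.SAW

namespace Summit.CriticalPhenomena.SAWScalingLimit.Theorems.ObservableToSLE.TypeLadder

open Summit.CriticalPhenomena.SAWScalingLimit.Theorems.ObservableToSLER.BridgeGate
open Summit.CriticalPhenomena.SAWScalingLimit.Theorems.ObservableToSLER.NestedGate

/-- **Registered stub S2 `stub_coOrientedReduction`** (line `six-class-type-ladder`, crux item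
stmt-CriticalPhenomena-10472): the carved sequential identification with tightness and modulus
given, for r7's class-zero fat anchored families, implies the same for the co-oriented fat
anchored families of this line (global `60°`-rotation covariance; see the module docstring). -/
theorem stub_coOrientedReduction :
    (∀ (D : DobrushinDomain) (a b : ℝ → HexVertex), IsEmbEndpointApprox hexGraph hexCenter D a b →
      ∀ (ν : Measure (CurveClass ℂ)), IsSLELaw ((8 : ℝ≥0) / 3) D ν →
      ∀ (f : CurveClass ℂ →ᵇ ℝ) (ε : ℝ), 0 < ε →
        ∃ R₀ > (0 : ℝ), ∀ R ∈ Set.Ioc (0 : ℝ) R₀, ∀ ρ > (0 : ℝ), ∀ N : ℕ,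
          ∀ (δ : ℕ → ℝ) (S T : ℕ → ℕ → Set HexVertex) (n n' : ℕ → ℕ) (q q' : ℕ → HexVertex),
            Tendsto δ atTop (𝓝[>] 0) →
            (∀ k, TameNestedFamily (δ k) R N (a (δ k)) (S k) ∧
              TameNestedFamily (δ k) R N (b (δ k)) (T k) ∧
              (((∀ i, ExteriorAnchored D.carrier (δ k) (S k i) (a (δ k))) ∧
          (∀ i, ExteriorAnchored D.carrier (δ k) (T k i) (b (δ k))) ∧
          (∀ (i : ℕ) (p q : HexVertex), HasCleanWindow D.carrier (δ k) ρ (S k i) p q →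
            rowOf 0 q = rowOf 0 p + 1 ∧
              ∀ x : HexVertex, ((δ k : ℝ) : ℂ) * hexCenter x ∈ ball (((δ k : ℝ) : ℂ) * hexCenter q) ρ →
                (x ∈ S k i ↔ rowOf 0 x ≤ rowOf 0 p)) ∧
          (∀ (i : ℕ) (p q : HexVertex), HasCleanWindow D.carrier (δ k) ρ (T k i) p q →
            rowOf 0 q = rowOf 0 p + 1 ∧
              ∀ x : HexVertex, ((δ k : ℝ) : ℂ) * hexCenter x ∈ ball (((δ k : ℝ) : ℂ) * hexCenter q) ρ →
                (x ∈ T k i ↔ rowOf 0 x ≤ rowOf 0 p))) ∧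
          (∀ (i : ℕ) (p q : HexVertex), HasCleanWindow D.carrier (δ k) ρ (S k i) p q →
            ∃ K : Set ℂ, IsCompact K ∧ IsConnected K ∧
              ((δ k : ℝ) : ℂ) * hexCenter q - ((ρ / 2 : ℝ) : ℂ) * Complex.I ∈ K ∧ ((δ k : ℝ) : ℂ) * hexCenter (a (δ k)) ∈ K ∧
              ∀ v : HexVertex, Metric.infDist (((δ k : ℝ) : ℂ) * hexCenter v) K ≤ ρ / 4 → v ∈ S k i) ∧
          (∀ (i : ℕ) (p q : HexVertex), HasCleanWindow D.carrier (δ k) ρ (T k i) p q →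
            ∃ K : Set ℂ, IsCompact K ∧ IsConnected K ∧
              ((δ k : ℝ) : ℂ) * hexCenter q - ((ρ / 2 : ℝ) : ℂ) * Complex.I ∈ K ∧ ((δ k : ℝ) : ℂ) * hexCenter (b (δ k)) ∈ K ∧
              ∀ v : HexVertex, Metric.infDist (((δ k : ℝ) : ℂ) * hexCenter v) K ≤ ρ / 4 → v ∈ T k i))) →
            (∀ k, ∃ (γ : HexDomainSAW D.carrier (δ k) (a (δ k)) (b (δ k))) (m : ℕ) (p : HexVertex)
                (m' : ℕ) (p' : HexVertex),
              IsFirstGoodGateN D.carrier (δ k) ρ R (S k) (a (δ k)) γ.walk.support (n k) m p (q k) ∧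
              IsFirstGoodGateN D.carrier (δ k) ρ R (T k) (b (δ k)) γ.walk.support.reverse
                (n' k) m' p' (q' k) ∧
              WideLink D.carrier (δ k) ρ (S k (n k) ∪ T k (n' k)) (q k) (q' k)) →
            (∀ k, IsProbabilityMeasure
              (carvedLaw D.carrier (δ k) (S k (n k) ∪ T k (n' k)) (q k) (q' k))) →
            (∀ η > (0 : ℝ), ∃ 𝒦 : Set (CurveClass ℂ), IsCompact 𝒦 ∧ ∀ᶠ k in atTop,
              carvedLaw D.carrier (δ k) (S k (n k) ∪ T k (n' k)) (q k) (q' k)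
                {ξ | ξ.curve ∉ 𝒦} ≤ ENNReal.ofReal η) →
            (∀ ε' > (0 : ℝ), ∀ η > (0 : ℝ), ∃ θ > (0 : ℝ), ∀ᶠ k in atTop,
              carvedLaw D.carrier (δ k) (S k (n k) ∪ T k (n' k)) (q k) (q' k)
                {ξ | ξ.curve ∉ CurveClass.modulusClass ε' θ} ≤ ENNReal.ofReal η) →
            ∀ᶠ k in atTop,
              |(∫ ξ, f ξ.curve ∂(carvedLaw D.carrier (δ k) (S k (n k) ∪ T k (n' k)) (q k) (q' k))) -
                  ∫ x, f x ∂ν| ≤ ε) →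
    ∀ (D : DobrushinDomain) (a b : ℝ → HexVertex), IsEmbEndpointApprox hexGraph hexCenter D a b →
      ∀ (ν : Measure (CurveClass ℂ)), IsSLELaw ((8 : ℝ≥0) / 3) D ν →
      ∀ (f : CurveClass ℂ →ᵇ ℝ) (ε : ℝ), 0 < ε →
        ∃ R₀ > (0 : ℝ), ∀ R ∈ Set.Ioc (0 : ℝ) R₀, ∀ ρ > (0 : ℝ), ∀ N : ℕ,
          ∀ (δ : ℕ → ℝ) (S T : ℕ → ℕ → Set HexVertex) (n n' : ℕ → ℕ) (q q' : ℕ → HexVertex),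
            Tendsto δ atTop (𝓝[>] 0) →
            (∀ k, TameNestedFamily (δ k) R N (a (δ k)) (S k) ∧
              TameNestedFamily (δ k) R N (b (δ k)) (T k) ∧
              ((∀ i, ExteriorAnchored D.carrier (δ k) (S k i) (a (δ k))) ∧
               (∀ i, ExteriorAnchored D.carrier (δ k) (T k i) (b (δ k))) ∧
               ∃ j : Fin 6,
                ((∀ (i : ℕ) (p q : HexVertex), HasCleanWindow D.carrier (δ k) ρ (S k i) p q →
                    rowOf j q = rowOf j p + 1 ∧
                      ∀ x : HexVertex, ((δ k : ℝ) : ℂ) * hexCenter x ∈ ball (((δ k : ℝ) : ℂ) * hexCenter q) ρ →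
                        (x ∈ S k i ↔ rowOf j x ≤ rowOf j p)) ∧
                  (∀ (i : ℕ) (p q : HexVertex), HasCleanWindow D.carrier (δ k) ρ (T k i) p q →
                    rowOf j q = rowOf j p + 1 ∧
                      ∀ x : HexVertex, ((δ k : ℝ) : ℂ) * hexCenter x ∈ ball (((δ k : ℝ) : ℂ) * hexCenter q) ρ →
                        (x ∈ T k i ↔ rowOf j x ≤ rowOf j p))) ∧
                (∀ (i : ℕ) (p q : HexVertex), HasCleanWindow D.carrier (δ k) ρ (S k i) p q →
                  ∃ K : Set ℂ, IsCompact K ∧ IsConnected K ∧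
                    ((δ k : ℝ) : ℂ) * hexCenter q - ((ρ / 2 : ℝ) : ℂ) * Complex.I * triZeta ^ (j : ℕ) ∈ K ∧
                    ((δ k : ℝ) : ℂ) * hexCenter (a (δ k)) ∈ K ∧
                    ∀ v : HexVertex, Metric.infDist (((δ k : ℝ) : ℂ) * hexCenter v) K ≤ ρ / 4 → v ∈ S k i) ∧
                (∀ (i : ℕ) (p q : HexVertex), HasCleanWindow D.carrier (δ k) ρ (T k i) p q →
                  ∃ K : Set ℂ, IsCompact K ∧ IsConnected K ∧
                    ((δ k : ℝ) : ℂ) * hexCenter q - ((ρ / 2 : ℝ) : ℂ) * Complex.I * triZeta ^ (j : ℕ) ∈ K ∧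
                    ((δ k : ℝ) : ℂ) * hexCenter (b (δ k)) ∈ K ∧
                    ∀ v : HexVertex, Metric.infDist (((δ k : ℝ) : ℂ) * hexCenter v) K ≤ ρ / 4 → v ∈ T k i))) →
            (∀ k, ∃ (γ : HexDomainSAW D.carrier (δ k) (a (δ k)) (b (δ k))) (m : ℕ) (p : HexVertex)
                (m' : ℕ) (p' : HexVertex),
              IsFirstGoodGateN D.carrier (δ k) ρ R (S k) (a (δ k)) γ.walk.support (n k) m p (q k) ∧
              IsFirstGoodGateN D.carrier (δ k) ρ R (T k) (b (δ k)) γ.walk.support.reverse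
                (n' k) m' p' (q' k) ∧
              WideLink D.carrier (δ k) ρ (S k (n k) ∪ T k (n' k)) (q k) (q' k)) →
            (∀ k, IsProbabilityMeasure
              (carvedLaw D.carrier (δ k) (S k (n k) ∪ T k (n' k)) (q k) (q' k))) →
            (∀ η > (0 : ℝ), ∃ 𝒦 : Set (CurveClass ℂ), IsCompact 𝒦 ∧ ∀ᶠ k in atTop,
              carvedLaw D.carrier (δ k) (S k (n k) ∪ T k (n' k)) (q k) (q' k)
                {ξ | ξ.curve ∉ 𝒦} ≤ ENNReal.ofReal η) →
            (∀ ε' > (0 : ℝ), ∀ η > (0 : ℝ), ∃ θ > (0 : ℝ), ∀ᶠ k in atTop,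
              carvedLaw D.carrier (δ k) (S k (n k) ∪ T k (n' k)) (q k) (q' k)
                {ξ | ξ.curve ∉ CurveClass.modulusClass ε' θ} ≤ ENNReal.ofReal η) →
            ∀ᶠ k in atTop,
              |(∫ ξ, f ξ.curve ∂(carvedLaw D.carrier (δ k) (S k (n k) ∪ T k (n' k)) (q k) (q' k))) -
                  ∫ x, f x ∂ν| ≤ ε := by
  intro hCZ D a b hab ν hν f ε hε
  -- rotated data, one for each class `j : Fin 6`
  have hc0 : ∀ j : Fin 6, conj (triZeta ^ (j : ℕ)) ≠ 0 := fun j => conj_triZeta_pow_ne_zero _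
  have hνr : ∀ j : Fin 6, IsSLELaw ((8 : ℝ≥0) / 3)
      (D.map (Homeomorph.mulLeft₀ (conj (triZeta ^ (j : ℕ))) (hc0 j)))
      (ν.map (CurveClass.map ⟨Homeomorph.mulLeft₀ (conj (triZeta ^ (j : ℕ))) (hc0 j),
        (Homeomorph.mulLeft₀ (conj (triZeta ^ (j : ℕ))) (hc0 j)).continuous⟩)) :=
    fun j => isSLELaw_map_of_eq_mul _ _ (hc0 j) (fun _ => rfl) _ D ν hν
  have habr : ∀ j : Fin 6, IsEmbEndpointApprox hexGraph hexCenter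
      (D.map (Homeomorph.mulLeft₀ (conj (triZeta ^ (j : ℕ))) (hc0 j)))
      (fun t => (hexRotIso (j : ℕ)).symm (a t)) (fun t => (hexRotIso (j : ℕ)).symm (b t)) :=
    fun j => isEmbEndpointApprox_rot (j : ℕ) D a b hab
  -- the class-zero statement for the six rotated data
  choose R₀ hR₀ H using fun j : Fin 6 => hCZ _ _ _ (habr j) _ (hνr j)
    (f.compContinuous ⟨CurveClass.map ⟨(Homeomorph.mulLeft₀ (conj (triZeta ^ (j : ℕ))) (hc0 j)).symm,
      (Homeomorph.mulLeft₀ (conj (triZeta ^ (j : ℕ))) (hc0 j)).symm.continuous⟩,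
      CurveClass.continuous_map _⟩) ε hε
  refine ⟨Finset.univ.inf' Finset.univ_nonempty R₀, (Finset.lt_inf'_iff _).2 fun j _ => hR₀ j, ?_⟩
  intro R hR ρ hρ N δ S T nn nn' q q' hδ hfam hcells hprob htight hmod
  -- the classes along the sequence
  choose jcl hjcl using fun k => (hfam k).2.2.2.2
  by_contra hcon
  -- pigeonhole on `Fin 6`: the conclusion fails frequently along ONE class
  have hfreq : ∃ j : Fin 6, ∃ᶠ k in atTop,
      ¬ |(∫ ξ, f ξ.curve ∂(carvedLaw D.carrier (δ k) (S k (nn k) ∪ T k (nn' k)) (q k) (q' k))) -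
          ∫ x, f x ∂ν| ≤ ε ∧ jcl k = j := by
    by_contra hall
    refine hcon ?_
    have hev : ∀ᶠ k in atTop, ∀ j : Fin 6,
        ¬ (¬ |(∫ ξ, f ξ.curve ∂(carvedLaw D.carrier (δ k) (S k (nn k) ∪ T k (nn' k)) (q k) (q' k))) -
            ∫ x, f x ∂ν| ≤ ε ∧ jcl k = j) :=
      Filter.eventually_all.2 fun j => Filter.not_frequently.1 (not_exists.1 hall j)
    exact hev.mono fun k hk => by_contra fun hk' => hk (jcl k) ⟨hk', rfl⟩
  obtain ⟨j, hj⟩ := hfreq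
  obtain ⟨ψ, hψ, hψP⟩ := Filter.extraction_of_frequently_atTop hj
  have hRj : R ∈ Set.Ioc (0 : ℝ) (R₀ j) :=
    ⟨hR.1, hR.2.trans (Finset.inf'_le _ (Finset.mem_univ j))⟩
  -- the SAW bijections at the gates, one per index of the subsequence
  have hEx : ∀ i, ∃ E : HexDomainSAW D.carrier (δ (ψ i)) (q (ψ i)) (q' (ψ i)) ≃
      HexDomainSAW ((fun z : ℂ => conj (triZeta ^ (j : ℕ)) * z) '' D.carrier) (δ (ψ i))
        ((hexRotIso (j : ℕ)).symm (q (ψ i))) ((hexRotIso (j : ℕ)).symm (q' (ψ i))),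
      ∀ γ, (E γ).walk.support = γ.walk.support.map ⇑(hexRotIso (j : ℕ)).symm :=
    fun i => exists_hexSAWRotEquiv (j : ℕ) D.carrier (δ (ψ i)) (q (ψ i)) (q' (ψ i))
  choose E hE using hEx
  -- apply the class-zero statement to the rotated subsequence
  have key := H j R hRj ρ hρ N (δ ∘ ψ) (fun i l => ⇑(hexRotIso (j : ℕ)).symm '' S (ψ i) l)
    (fun i l => ⇑(hexRotIso (j : ℕ)).symm '' T (ψ i) l) (nn ∘ ψ) (nn' ∘ ψ)
    (fun i => (hexRotIso (j : ℕ)).symm (q (ψ i))) (fun i => (hexRotIso (j : ℕ)).symm (q' (ψ i)))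
    (hδ.comp hψ.tendsto_atTop) ?_ ?_ ?_ ?_ ?_
  · -- transport the conclusion back: contradiction with the choice of `ψ`
    obtain ⟨i, hi⟩ := key.exists
    refine (hψP i).1 ?_
    have e3 : ∀ x : CurveClass ℂ,
        CurveClass.map ⟨(Homeomorph.mulLeft₀ (conj (triZeta ^ (j : ℕ))) (hc0 j)).symm,
            (Homeomorph.mulLeft₀ (conj (triZeta ^ (j : ℕ))) (hc0 j)).symm.continuous⟩
          (CurveClass.map ⟨fun z : ℂ => conj (triZeta ^ (j : ℕ)) * z, continuous_const_mul _⟩ x) = x :=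
      fun x => curveClassMap_symm_map (Homeomorph.mulLeft₀ (conj (triZeta ^ (j : ℕ))) (hc0 j)) x
    have e4 : ∀ x : CurveClass ℂ,
        CurveClass.map ⟨(Homeomorph.mulLeft₀ (conj (triZeta ^ (j : ℕ))) (hc0 j)).symm,
            (Homeomorph.mulLeft₀ (conj (triZeta ^ (j : ℕ))) (hc0 j)).symm.continuous⟩
          (CurveClass.map ⟨Homeomorph.mulLeft₀ (conj (triZeta ^ (j : ℕ))) (hc0 j),
            (Homeomorph.mulLeft₀ (conj (triZeta ^ (j : ℕ))) (hc0 j)).continuous⟩ x) = x :=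
      fun x => curveClassMap_symm_map (Homeomorph.mulLeft₀ (conj (triZeta ^ (j : ℕ))) (hc0 j)) x
    convert hi using 3
    · have e1 := integral_carvedLaw_rot (U := S (ψ i) (nn (ψ i)) ∪ T (ψ i) (nn' (ψ i))) (hE i)
        ⇑(f.compContinuous ⟨CurveClass.map
          ⟨(Homeomorph.mulLeft₀ (conj (triZeta ^ (j : ℕ))) (hc0 j)).symm,
            (Homeomorph.mulLeft₀ (conj (triZeta ^ (j : ℕ))) (hc0 j)).symm.continuous⟩,
          CurveClass.continuous_map _⟩)
      rw [Set.image_union] at e1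
      refine Eq.trans ?_ e1.symm
      simp only [BoundedContinuousFunction.compContinuous_apply, ContinuousMap.coe_mk, e3]
    · rw [integral_map_curveClassMap]
      simp only [BoundedContinuousFunction.compContinuous_apply, ContinuousMap.coe_mk, e4]
  · -- tame rotated families under r7's class-zero constraint
    intro i
    obtain ⟨hS, hT, hanS, hanT, -⟩ := hfam (ψ i)
    obtain ⟨⟨hwS, hwT⟩, hfS, hfT⟩ := hjcl (ψ i)
    have hji : (jcl (ψ i) : ℕ) = (j : ℕ) := by rw [(hψP i).2]
    refine ⟨tameNestedFamily_rot (j : ℕ) (δ (ψ i)) R N _ _ hS, tameNestedFamily_rot (j : ℕ) (δ (ψ i)) R N _ _ hT,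
      ⟨fun l => exteriorAnchored_rot (j : ℕ) D.carrier (δ (ψ i)) _ _ (hanS l),
        fun l => exteriorAnchored_rot (j : ℕ) D.carrier (δ (ψ i)) _ _ (hanT l),
        classZeroWindows_rot (j : ℕ) D.carrier (δ (ψ i)) ρ (jcl (ψ i)) hji _ hwS,
        classZeroWindows_rot (j : ℕ) D.carrier (δ (ψ i)) ρ (jcl (ψ i)) hji _ hwT⟩,
      fatUnderWindow_rot (j : ℕ) D.carrier (δ (ψ i)) ρ (jcl (ψ i)) hji _ _ hfS,
      fatUnderWindow_rot (j : ℕ) D.carrier (δ (ψ i)) ρ (jcl (ψ i)) hji _ _ hfT⟩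
  · -- realised cells
    intro i
    exact cells_rot (j : ℕ) D.carrier (δ (ψ i)) ρ R (S (ψ i)) (T (ψ i)) (a (δ (ψ i))) (b (δ (ψ i)))
      (nn (ψ i)) (nn' (ψ i)) (q (ψ i)) (q' (ψ i)) (hcells (ψ i))
  · -- probability carved laws
    intro i
    have h := isProbabilityMeasure_carvedLaw_rot (U := S (ψ i) (nn (ψ i)) ∪ T (ψ i) (nn' (ψ i)))
      (hE i) (hprob (ψ i))
    simp only [Function.comp_apply, Set.image_union] at h ⊢
    exact h
  · -- tightness: rotate the compact sets
    intro η hη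
    obtain ⟨K, hK, hev⟩ := htight η hη
    refine ⟨CurveClass.map ⟨fun z : ℂ => conj (triZeta ^ (j : ℕ)) * z, continuous_const_mul _⟩ '' K,
      hK.image (CurveClass.continuous_map _), ?_⟩
    filter_upwards [hψ.tendsto_atTop.eventually hev] with i hi
    have e := carvedLaw_rot_apply_curve (U := S (ψ i) (nn (ψ i)) ∪ T (ψ i) (nn' (ψ i))) (hE i)
      (fun c => c ∉ CurveClass.map ⟨fun z : ℂ => conj (triZeta ^ (j : ℕ)) * z, continuous_const_mul _⟩ '' K)
    have hinj : Function.Injective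
        (CurveClass.map ⟨fun z : ℂ => conj (triZeta ^ (j : ℕ)) * z, continuous_const_mul _⟩) :=
      Function.LeftInverse.injective
        (g := CurveClass.map ⟨(Homeomorph.mulLeft₀ (conj (triZeta ^ (j : ℕ))) (hc0 j)).symm,
          (Homeomorph.mulLeft₀ (conj (triZeta ^ (j : ℕ))) (hc0 j)).symm.continuous⟩)
        fun x => curveClassMap_symm_map (Homeomorph.mulLeft₀ (conj (triZeta ^ (j : ℕ))) (hc0 j)) x
    simp only [hinj.mem_set_image, Set.image_union] at e
    exact e.le.trans hi
  · -- moduli: isometry invariance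
    intro ε' hε' η hη
    obtain ⟨θ, hθ, hev⟩ := hmod ε' hε' η hη
    refine ⟨θ, hθ, ?_⟩
    filter_upwards [hψ.tendsto_atTop.eventually hev] with i hi
    have e := carvedLaw_rot_apply_curve (U := S (ψ i) (nn (ψ i)) ∪ T (ψ i) (nn' (ψ i))) (hE i)
      (fun c => c ∉ CurveClass.modulusClass ε' θ)
    have hiso : ∀ x : CurveClass ℂ,
        CurveClass.map ⟨fun z : ℂ => conj (triZeta ^ (j : ℕ)) * z, continuous_const_mul _⟩ x ∈
            CurveClass.modulusClass ε' θ ↔ x ∈ CurveClass.modulusClass ε' θ :=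
      fun x => curveClassMap_mem_modulusClass_iff
        (Homeomorph.mulLeft₀ (conj (triZeta ^ (j : ℕ))) (hc0 j)) (isometry_conj_triZeta_pow_mul (j : ℕ)) ε' θ x
    simp only [hiso, Set.image_union] at e
    exact e.le.trans hi

end Summit.CriticalPhenomena.SAWScalingLimit.Theorems.ObservableToSLE.TypeLadder

end
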